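import Summits.FinalStateConjecture.FinalStateConjecture.Theorems.ClusterCompletenessAdiabaticMultiKerrILEDRedShiftLocal
import Summits.FinalStateConjecture.FinalStateConjecture.Theorems.ClusterCompletenessAdiabaticMultiKerrILEDTailsCutWaveOperatorFacts
import Summits.FinalStateConjecture.FinalStateConjecture.Theorems.ClusterCompletenessAdiabaticMultiKerrILEDSlabBookkeeping

/-!
# Route ClusterCompleteness — crux `AdiabaticMultiKerrILED`, line `Sketch`:
# the horizon collar of the rest-frame ILED (zero spin) via the local red-shift estimate

Helper file for the crux `stmt-FinalStateConjecture-14310`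
(`Summit.FinalStateConjecture.FinalStateConjecture.Theses.ClusterCompleteness.AdiabaticMultiKerrILED`),
line `Sketch` (lead c7, wave 9): the landed local red-shift estimate `stub_redShiftLocal`
(Dafermos–Rodnianski–Shlapentokh-Rothman arXiv:1402.7034, Prop. 4.5.2 / §13.2) specialised to the
static tails-cut Schwarzschild zone at zero spin (`r₊ = 2M`, `r = ‖y‖` on the leaves, slope
`c = 1/2`, the tails-cut field agreeing with Schwarzschild inside `r < 8M`,
`waveOperator_tailsCut_eq_schwarzschild`), written with set integrals: for a collar width
`η = η(M) ∈ (0, M/4]` the space-time energy in `(0, s] × {2M < ‖y‖ ≤ 2M + η/2}` is bounded by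
the initial energy and the space-time energy in the shell `{2M + η/2 ≤ ‖y‖ ≤ 2M + η}`.
Registered anchor: `collar_ILED_le`. [folklore]
-/

noncomputable section

-- the doubled `FinalStateConjecture.FinalStateConjecture` path component trips dupNamespace
set_option linter.dupNamespace false

open Set MeasureTheory
open scoped ENNReal
open Literature.Geometry.Lorentzian

namespace Summit.FinalStateConjecture.FinalStateConjecture.Theorems

/-- **The horizon collar of the rest-frame ILED at zero spin** (registered anchor
`collar_ILED_le`): for `M > 0` there are a collar width `0 < η ≤ M/4` and a constant `C` such that
for every `C²` height `F` of slope `≤ 1/2`, every `Φ ∈ C²(ℝ⁴)` solving the tails-cut wave equation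
on `{F ≤ x⁰} ∩ {r > 2M}`, and every `s ≥ 0`,
`∫_{(0,s]} ∫_{2M<‖y‖≤2M+η/2} e[Φ] ≤ C (∫_{2M<‖y‖} e[Φ](leaf 0) + ∫_{(0,s]} ∫_{2M+η/2≤‖y‖≤2M+η} e[Φ])`
(`e[Φ] = ∑_μ(∂_μΦ)²` at the leaf point `(u + F(y), y)`). This is `stub_redShiftLocal` at `a = 0`,
`c = 1/2`, with the equation transferred by `waveOperator_tailsCut_eq_schwarzschild`.
DRSR arXiv:1402.7034, Prop. 4.5.2. [cite: DafermosRodnianskiShlapentokhrothman2014, Prop. 4.5.2] -/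
theorem collar_ILED_le : ∀ (M : ℝ), 0 < M → ∃ η : ℝ, 0 < η ∧ η ≤ M / 4 ∧ ∃ C : NNReal, ∀ (F : E3 → ℝ) (Φ : E4 → ℝ) (s : ℝ), ContDiff ℝ 2 F → (∀ y, ‖fderiv ℝ F y‖ ≤ 2⁻¹) → ContDiff ℝ 2 Φ → (∀ x : E4, F (E4.spatial x) ≤ x 0 → 2 * M < Kerr.radius 0 x → KerrSchild.waveOperator (KerrSchild.inverseMetric (fun y ↦ Real.smoothTransition (2 - Kerr.radius 0 y / (8 * M)) * (2 * Kerr.scalarH M 0 y)) (Kerr.nullVector 0)) Φ x = 0) → 0 ≤ s → ∫⁻ u in Set.Ioc 0 s, ∫⁻ y in {y : E3 | 2 * M < ‖y‖ ∧ ‖y‖ ≤ 2 * M + η / 2}, ENNReal.ofReal (∑ μ : Fin 4, fderiv ℝ Φ (E4.ofTimeSpace (u + F y) y) (E4.basisVector μ) ^ 2) ≤ (C : ENNReal) * ((∫⁻ y in {y : E3 | 2 * M < ‖y‖}, ENNReal.ofReal (∑ μ : Fin 4, fderiv ℝ Φ (E4.ofTimeSpace (0 + F y) y) (E4.basisVector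 μ) ^ 2)) + ∫⁻ u in Set.Ioc 0 s, ∫⁻ y in {y : E3 | 2 * M + η / 2 ≤ ‖y‖ ∧ ‖y‖ ≤ 2 * M + η}, ENNReal.ofReal (∑ μ : Fin 4, fderiv ℝ Φ (E4.ofTimeSpace (u + F y) y) (E4.basisVector μ) ^ 2)) := by
  intro M hM
  have hsub : Kerr.IsSubextremal M 0 := by
    show |(0 : ℝ)| < M
    simpa using hM
  obtain ⟨η₀, hη₀, hRS⟩ :=
    Summit.FinalStateConjecture.FinalStateConjecture.Cruxes.AdiabaticMultiKerrILED.Sketch.stub_redShiftLocal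
      M 0 hsub
  set η : ℝ := min η₀ (M / 4) with hηdef
  have hη : 0 < η := lt_min hη₀ (by positivity)
  have hηη₀ : η ≤ η₀ := min_le_left _ _
  have hη4 : η ≤ M / 4 := min_le_right _ _
  obtain ⟨Crs, hCrs, hest⟩ := hRS η hη hηη₀
  refine ⟨η, hη, hη4, (ENNReal.ofReal (Crs / 2⁻¹)).toNNReal, ?_⟩
  intro F Φ s hF hdF hΦ hsol hs
  rw [ENNReal.coe_toNNReal ENNReal.ofReal_ne_top]
  have hrp : Kerr.rPlus M 0 = 2 * M := Kerr.rPlus_zero_right hM.le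
  have hrad : ∀ (t : ℝ) (y : E3), Kerr.radius 0 (E4.ofTimeSpace t y) = ‖y‖ := fun t y ↦ by
    rw [Kerr.radius_zero_left, E4.spatialNorm_ofTimeSpace]
  -- the hypotheses of the red-shift estimate
  have hslope : ∀ y, ‖fderiv ℝ F y‖ ≤ 1 - 2⁻¹ := fun y ↦ (hdF y).trans_eq (by norm_num)
  have hreg : ∀ x ∈ (Kerr.exterior M 0 : Set E4), ContDiffAt ℝ 2 Φ x := fun x _ ↦ hΦ.contDiffAt
  have heq : ∀ x ∈ (Kerr.exterior M 0 : Set E4), Kerr.radius 0 x ≤ Kerr.rPlus M 0 + η →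
      F (E4.spatial x) ≤ x 0 →
      KerrSchild.waveOperator
        (KerrSchild.inverseMetric (fun y ↦ 2 * Kerr.scalarH M 0 y) (Kerr.nullVector 0)) Φ x = 0 := by
    intro x hx hxη hxF
    have hx' : 2 * M < Kerr.radius 0 x := by
      have h := (Kerr.mem_exterior.mp hx)
      rw [hrp] at h
      exact lt_of_le_of_lt (le_max_left _ _) h
    have h8 : Kerr.radius 0 x < 8 * M := by rw [hrp] at hxη; linarith
    rw [← waveOperator_tailsCut_eq_schwarzschild M Φ x hM h8]
    exact hsol x hxF hx'
  have h := hest F 2⁻¹ hF (by norm_num) (by norm_num) hslope Φ hreg heq s hs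
  -- rewrite radii and horizon radius on the leaves, indicators as set integrals
  simp only [hrad, hrp] at h
  have e1 : ∀ (t : ℝ) (a b : ℝ),
      (∫⁻ y, {y : E3 | a < ‖y‖ ∧ ‖y‖ ≤ b}.indicator (fun y ↦ ENNReal.ofReal
        (∑ μ : Fin 4, fderiv ℝ Φ (E4.ofTimeSpace (t + F y) y) (E4.basisVector μ) ^ 2)) y) =
      ∫⁻ y in {y : E3 | a < ‖y‖ ∧ ‖y‖ ≤ b}, ENNReal.ofReal
        (∑ μ : Fin 4, fderiv ℝ Φ (E4.ofTimeSpace (t + F y) y) (E4.basisVector μ) ^ 2) :=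
    fun t a b ↦ lintegral_indicator (measurableSet_norm_Ioc a b) _
  have e2 : ∀ (t : ℝ) (a b : ℝ),
      (∫⁻ y, {y : E3 | a ≤ ‖y‖ ∧ ‖y‖ ≤ b}.indicator (fun y ↦ ENNReal.ofReal
        (∑ μ : Fin 4, fderiv ℝ Φ (E4.ofTimeSpace (t + F y) y) (E4.basisVector μ) ^ 2)) y) =
      ∫⁻ y in {y : E3 | a ≤ ‖y‖ ∧ ‖y‖ ≤ b}, ENNReal.ofReal
        (∑ μ : Fin 4, fderiv ℝ Φ (E4.ofTimeSpace (t + F y) y) (E4.basisVector μ) ^ 2) :=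
    fun t a b ↦ lintegral_indicator (measurableSet_norm_Icc a b) _
  simp only [e1, e2] at h
  -- drop the leaf term on the left, enlarge the initial collar energy to the full energy
  calc ∫⁻ u in Set.Ioc 0 s, ∫⁻ y in {y : E3 | 2 * M < ‖y‖ ∧ ‖y‖ ≤ 2 * M + η / 2},
        ENNReal.ofReal (∑ μ : Fin 4, fderiv ℝ Φ (E4.ofTimeSpace (u + F y) y) (E4.basisVector μ) ^ 2)
      ≤ _ := le_add_self
    _ ≤ _ := h
    _ ≤ _ := by
        refine mul_le_mul_right (add_le_add (lintegral_mono_set fun y hy ↦ hy.1) le_rfl) _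

end Summit.FinalStateConjecture.FinalStateConjecture.Theorems
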